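import Summits.QuantumFields.YangMills.Theorems.BalabanUVNodesPortS1G3CDefsL
import Summits.QuantumFields.YangMills.Theorems.BalabanUVNodesN09BackgroundRadiiTransfer
import Literature.MathematicalPhysics.QuantumFieldTheory.Balaban1983to89.Node00.SmallFieldChi29AxOfRecord
import Literature.MathematicalPhysics.QuantumFieldTheory.Balaban1983to89.B10Eq71TorusLocal

/-!
# NODE O port — `stub_P0C` (the guarded P0-ℂ letter `P0HolExtAtRecordGL`), bricks B + C: (P4-lat) ⇒ (P4)-SCHUR, and THE RADIUS REDUCTION OF THE ROOTED SELECTOR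
# (memo `Cruxes/PortRecordRepresentationS1/Lines/pta_residueW-stub_P0C-hand.md` §2 (P4-lat) and §3 R1)

Porter hand `hand-27930-P0C` (g0), `--supports stmt-QuantumFields-27930 --as helper`; count-neutral.  [15] = [Balaban1985Variational], [I] = [Balaban1987RG1],
[B9] = [Balaban1985BackgroundPropagators].

WHY (B).  The body of `P0HolExtAtRecordGL` asks BOTH the unweighted Schur clause (P4-e) of `P0CarrierClauses` and the lattice-weighted one (P4-lat) `P0CarrierLatticeDecay`;
the weight `exp(δ₁·tdist) ≥ 1` makes the former a consequence of the latter (node00-def-Y O.5375: «(P4) and (P4-lat) are ONE inequality (the unweighted Schur clause is the case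
δ₁ = 0)»), so a supplier proves (P4-lat) only.

WHY (C).  The letter is typed for EVERY `a₀ > 0` under the TokE guard (existence + uniqueness of the (0.21) minimal orbit at radius `a₀`), while print's Thm 1 ([15] p.279)
lives at `ε₀ ≤ a₀ᴾ`; rows (P2)∕(P5) read the record's selectors `UkSel … a₀ …` ∕ `critCfgAxOfRecord θ.ν` AT RADIUS `a₀`, eventually near `B = 0`.  The reduction: under
UNIQUENESS at the larger radius `ε′`, a minimiser at a smaller radius `ε ≤ ε′` whose action lies below the ONE-BAD-PLAQUETTE FLOOR `(ε·η_k²)²∕(2N)` of the larger class IS a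
minimiser of the larger class (every competitor outside the small class has a plaquette with `|U(∂p) − 1| ≥ εη²`, hence action `≥ (εη²)²∕(2N)` by [16] (11) `|U−1|² ≤ 2N(1 − Re tr U)`),
so the rooted selectors at the two radii COINCIDE (canonicity ✓`rootGauge_eq_UkSel_of_isBackground`) and so do the block-axial critical configurations of record.  Near the flat
point the small-radius minimiser has small action ([15] Thm 1 (8)), so the `∀ a₀ > 0` prefix costs the supplier this lemma, not an edition.

WHAT THIS FILE PROVES (sorry-free):
* (B) `schur_of_latticeDecay` — `P0CarrierLatticeDecay F δ₀ c₀ δ₁ Mc α₀ α₁ k TY → 0 ≤ δ₁ →` the row∕column Schur bounds of (P4-e), verbatim.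
* (C) `sq_div_le_wilsonAction4_of_not_mem_bgReg` (the one-bad-plaquette floor); `mem_bgReg_of_isBackground_of_action_lt` (under the floor EVERY large-radius minimiser is
  small-radius regular — the (8)-membership input `hreg8` of dag-n09-w1's ✓`…N09BackgroundRadiiTransfer`, which moves [B11]'s clauses the OTHER way, large → small radius;
  its `bgReg_mono` is REUSED); `isBackground_of_radius_le` (a small-radius minimiser below the floor is a large-radius minimiser); `ukExists_of_radius_le`; ★ `ukSel_eq_of_radius_le` (the rooted selectors at two radii agree under uniqueness at the larger one + the floor);
  ★ `ukSel_eq_of_radius_le_of_action_lt` (the same with the floor discharged by the action bound); ★ `critCfgAxOfRecord_eq_of_radius_le` (the block-axial critical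
  configuration of record at radius `ν.εreg` is the axialised average of ANY smaller-radius minimiser below the floor).

HONEST FRAMING.  Elementary bookkeeping on the (0.21) selector + one trace inequality; the [B11] tokens `UkExists`∕`UniqueUkOrbit` are HYPOTHESES, never asserted; nothing of
Bałaban discharged; `stub_P0C` NOT closed; ⟨27930⟩ OPEN; NODE O 0∕1; COUNT 8∕28 · K 1∕4 UNMOVED; finite `𝕋⁴_{L^K}` at fixed ε — NOT continuum ∕ OS ∕ Clay; **the Yang–Mills mass
gap is NOT proved by any of this.**  No `sorry`, no `instance`, no `notation`, no `def`; standard axioms.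
-/

noncomputable section

open scoped BigOperators

namespace Summit.QuantumFields.YangMills.Theorems.BalabanUVNodesPortS1

open Summit.QuantumFields.YangMills.Theorems.K0RecordFormatNames
open Literature.MathematicalPhysics.QuantumFieldTheory.Balaban1983to89
open Literature.MathematicalPhysics.QuantumFieldTheory.Balaban1983to89.Node00
open Literature.MathematicalPhysics.QuantumFieldTheory.Balaban1983to89.T4Continuum (T4Family)

/-! ## (B)  (P4-lat) implies (P4)'s Schur clause -/

section SchurOfLattice

variable (F : T4Family)

/-- **(P4-lat) ⇒ (P4-e)**: the lattice-weighted Schur decay `P0CarrierLatticeDecay` (weight `exp(δ₁·tdist) ≥ 1` for `δ₁ ≥ 0`) implies the unweighted row∕column Schur bounds of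
(P4) of `P0CarrierClauses`, with the same constants — a supplier proves the weighted clause only. [cite: Balaban1985BackgroundPropagators, (3.42) p.399 (bookkeeping)] -/
theorem schur_of_latticeDecay {δ₀ c₀ δ₁ : ℝ} {Mc : ℕ} {α₀ α₁ : ℝ} {k : ℕ}
    {TY : (n : ℕ) → (recordDomSys F Mc k (recordK₀ F Mc k + n)).Dom → Sect2.CPair (F.P (recordK₀ F Mc k + n)) (MatA 2) →
        FluctIdx F k (recordK₀ F Mc k + n) → FluctIdx F k (recordK₀ F Mc k + n) → ℂ}
    (hL : P0CarrierLatticeDecay F δ₀ c₀ δ₁ Mc α₀ α₁ k TY) (hδ₁ : 0 ≤ δ₁)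
    (n : ℕ) (Y : (recordDomSys F Mc k (recordK₀ F Mc k + n)).Dom) (φ : Sect2.CPair (F.P (recordK₀ F Mc k + n)) (MatA 2))
    (hφ : encodeCfg F (recordK₀ F Mc k + n) φ ∈ recordUc F Mc k α₀ α₁ (recordK₀ F Mc k + n) Y) :
    (∀ i : FluctIdx F k (recordK₀ F Mc k + n),
        ∑ j : FluctIdx F k (recordK₀ F Mc k + n), ‖TY n Y φ i j‖ ≤ c₀ * Real.exp (-(δ₀ * (recordDomSys F Mc k (recordK₀ F Mc k + n)).dj Y))) ∧
      (∀ j : FluctIdx F k (recordK₀ F Mc k + n),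
        ∑ i : FluctIdx F k (recordK₀ F Mc k + n), ‖TY n Y φ i j‖ ≤ c₀ * Real.exp (-(δ₀ * (recordDomSys F Mc k (recordK₀ F Mc k + n)).dj Y))) := by
  obtain ⟨hrow, hcol⟩ := hL n Y φ hφ
  have hw : ∀ i j : FluctIdx F k (recordK₀ F Mc k + n),
      ‖TY n Y φ i j‖ ≤ ‖TY n Y φ i j‖ * Real.exp (δ₁ * (Site.tdist i.1.src j.1.src : ℝ)) := by
    intro i j
    have h1 : (1 : ℝ) ≤ Real.exp (δ₁ * (Site.tdist i.1.src j.1.src : ℝ)) :=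
      Real.one_le_exp (mul_nonneg hδ₁ (Nat.cast_nonneg _))
    simpa using mul_le_mul_of_nonneg_left h1 (norm_nonneg (TY n Y φ i j))
  exact ⟨fun i => (Finset.sum_le_sum fun j _ => hw i j).trans (hrow i), fun j => (Finset.sum_le_sum fun i _ => hw i j).trans (hcol j)⟩

end SchurOfLattice

/-! ## (C)  The radius reduction of the rooted selector -/

section Radius

open Summit.QuantumFields.YangMills.BalabanUVNodes.N09BackgroundRadiiTransfer (bgReg_mono)

variable {F : T4Family} {N : ℕ} [NeZero N] {K k : ℕ} {ε ε' : ℝ}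

/-- **THE ONE-BAD-PLAQUETTE FLOOR**: a configuration OUTSIDE the regularity class of radius `ε ≥ 0` has Wilson action `≥ (ε·η_k²)²∕(2N)` ([16] (11): `|U − 1|² ≤ 2N(1 − Re tr U)`
for the plaquette with `|U(∂p) − 1| ≥ εη²`, all other terms `≥ 0`). [cite: Balaban1985UV3, (11) p.258; Balaban1987RG1, (1.2) p.260] -/
theorem sq_div_le_wilsonAction4_of_not_mem_bgReg (hε : 0 ≤ ε) {U : GaugeField (F.P K) 0 (SU N)} (hU : U ∉ bgReg F N K k ε) :
    (ε * (F.P K).eta k ^ 2) ^ 2 / (2 * N) ≤ wilsonAction4 U := by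
  rw [mem_bgReg_iff, PlaqSmall] at hU
  push Not at hU
  obtain ⟨p, hp⟩ := hU
  have hN : (0 : ℝ) < 2 * N := by
    have : (0 : ℝ) < N := by exact_mod_cast Nat.pos_of_ne_zero (NeZero.ne N)
    linarith
  have hterm : (ε * (F.P K).eta k ^ 2) ^ 2 / (2 * N) ≤ 1 - reTr (GaugeField.plaqHol U p) := by
    rw [div_le_iff₀ hN]
    have h1 : (ε * (F.P K).eta k ^ 2) ^ 2 ≤ dist1 (GaugeField.plaqHol U p) ^ 2 :=
      pow_le_pow_left₀ (mul_nonneg hε (sq_nonneg _)) hp 2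
    have h2 := B10Eq71TorusLocal.dist1_sq_le_specialUnitaryGroup (N := N) (GaugeField.plaqHol U p)
    nlinarith
  refine hterm.trans ?_
  unfold wilsonAction4 wilsonAction
  rw [← Finset.sum_erase_add _ _ (Finset.mem_univ p), one_mul]
  have hrest : 0 ≤ ∑ q ∈ Finset.univ.erase p, (1 : ℝ) * (1 - reTr (GaugeField.plaqHol U q)) :=
    Finset.sum_nonneg fun q _ => by
      have := GaugeGroup.reTr_le_one (GaugeField.plaqHol U q)
      linarith
  linarith

/-- **UNDER THE FLOOR EVERY LARGE-RADIUS MINIMISER IS SMALL-RADIUS REGULAR**: if some competitor `U₀ ∈ bgReg ε′` over `V` has action `< (ε·η_k²)²∕(2N)`, then every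
radius-`ε′` minimiser over `V` lies in `bgReg ε` — the (8)-membership clause `hreg8` that ✓`…N09BackgroundRadiiTransfer` takes as input, discharged by an action bound.
[cite: Balaban1985Variational, Thm 1 (8) p.279; Balaban1985UV3, (11) p.258] -/
theorem mem_bgReg_of_isBackground_of_action_lt (hε : 0 ≤ ε) {V : GaugeField (F.P K) k (SU N)} {U₀ U₁ : GaugeField (F.P K) 0 (SU N)}
    (hU₀ : U₀ ∈ bgReg F N K k ε') (hU₀V : Averaging.iter (avOfRecord F N K) k U₀ = V)
    (hsmall : wilsonAction4 U₀ < (ε * (F.P K).eta k ^ 2) ^ 2 / (2 * N))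
    (h₁ : IsBackground (avOfRecord F N K) (bgReg F N K k ε') k V U₁) : U₁ ∈ bgReg F N K k ε := by
  by_contra hU₁
  have hle := h₁.2.2 U₀ hU₀ hU₀V
  have hfl := sq_div_le_wilsonAction4_of_not_mem_bgReg (F := F) (N := N) (K := K) (k := k) hε hU₁
  linarith

/-- **A small-radius minimiser below the floor of the larger class is a minimiser of the larger class**: `IsBackground` at radius `ε` with action dominated by every competitor
of `bgReg ε′ ∖ bgReg ε` gives `IsBackground` at radius `ε′ ≥ ε`. [cite: Balaban1985Variational, Thm 1 p.279; Balaban1987RG1, (0.21) p.256] -/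
theorem isBackground_of_radius_le (h : ε ≤ ε') {V : GaugeField (F.P K) k (SU N)} {U₀ : GaugeField (F.P K) 0 (SU N)}
    (h₀ : IsBackground (avOfRecord F N K) (bgReg F N K k ε) k V U₀)
    (hfloor : ∀ U : GaugeField (F.P K) 0 (SU N), U ∈ bgReg F N K k ε' → U ∉ bgReg F N K k ε →
      Averaging.iter (avOfRecord F N K) k U = V → wilsonAction4 U₀ ≤ wilsonAction4 U) :
    IsBackground (avOfRecord F N K) (bgReg F N K k ε') k V U₀ := by
  refine ⟨h₀.1, bgReg_mono h h₀.2.1, fun U hU hUV => ?_⟩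
  by_cases hUε : U ∈ bgReg F N K k ε
  · exact h₀.2.2 U hUε hUV
  · exact hfloor U hU hUε hUV

/-- Solvability passes to the larger radius under the floor condition. [cite: Balaban1985Variational, Thm 1 p.279 (bookkeeping)] -/
theorem ukExists_of_radius_le (h : ε ≤ ε') {V : GaugeField (F.P K) k (SU N)} {U₀ : GaugeField (F.P K) 0 (SU N)}
    (h₀ : IsBackground (avOfRecord F N K) (bgReg F N K k ε) k V U₀)
    (hfloor : ∀ U : GaugeField (F.P K) 0 (SU N), U ∈ bgReg F N K k ε' → U ∉ bgReg F N K k ε →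
      Averaging.iter (avOfRecord F N K) k U = V → wilsonAction4 U₀ ≤ wilsonAction4 U) :
    UkExists F N K k ε' V :=
  ⟨U₀, isBackground_of_radius_le h h₀ hfloor⟩

/-- ★ **THE RADIUS REDUCTION OF THE ROOTED SELECTOR**: if (0.21) is solvable at radius `ε`, the minimal orbit at radius `ε′ ≥ ε` is UNIQUE, and the radius-`ε` selector's action is
dominated by every competitor of `bgReg ε′ ∖ bgReg ε`, then `UkSel … ε … V = UkSel … ε′ … V`. [cite: Balaban1985Variational, Thm 1 p.279, (181) p.307; Balaban1987RG1, (0.21) p.256] -/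
theorem ukSel_eq_of_radius_le (hk : k ≤ (F.P K).m + (F.P K).K) (h : ε ≤ ε') {V : GaugeField (F.P K) k (SU N)}
    (hex : UkExists F N K k ε V) (hu' : UniqueUkOrbit F N K k ε' V)
    (hfloor : ∀ U : GaugeField (F.P K) 0 (SU N), U ∈ bgReg F N K k ε' → U ∉ bgReg F N K k ε →
      Averaging.iter (avOfRecord F N K) k U = V → wilsonAction4 (UkSel F N K k ε V) ≤ wilsonAction4 U) :
    UkSel F N K k ε V = UkSel F N K k ε' V := by
  have h₀ := isBackground_UkSel hk hex
  have h₀' := isBackground_of_radius_le h h₀ hfloor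
  rw [← rootGauge_eq_UkSel_of_isBackground hk hu' h₀', rootGauge_UkSel hk]

/-- ★ **THE SAME WITH THE FLOOR DISCHARGED BY AN ACTION BOUND**: if moreover the radius-`ε` selector has action `< (ε·η_k²)²∕(2N)` (near the flat point: [15] Thm 1 (8)), then the
selectors at the two radii coincide. [cite: Balaban1985Variational, Thm 1 (8) p.279; Balaban1985UV3, (11) p.258] -/
theorem ukSel_eq_of_radius_le_of_action_lt (hk : k ≤ (F.P K).m + (F.P K).K) (hε : 0 ≤ ε) (h : ε ≤ ε') {V : GaugeField (F.P K) k (SU N)}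
    (hex : UkExists F N K k ε V) (hu' : UniqueUkOrbit F N K k ε' V)
    (hsmall : wilsonAction4 (UkSel F N K k ε V) < (ε * (F.P K).eta k ^ 2) ^ 2 / (2 * N)) :
    UkSel F N K k ε V = UkSel F N K k ε' V :=
  ukSel_eq_of_radius_le hk h hex hu' fun _ _ hUε _ => (hsmall.trans_le (sq_div_le_wilsonAction4_of_not_mem_bgReg hε hUε)).le

/-- ★ **THE SAME FOR THE BLOCK-AXIAL CRITICAL CONFIGURATION OF RECORD**: at radius `ν.εreg`, under uniqueness there, `V^{(k)}_{ax}(W)` is the axialised k-fold average of ANY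
minimiser `U₀` of a smaller radius `ε ≤ ν.εreg` whose action lies below the floor `(ε·η_{k+1}²)²∕(2N)` — so the record's (2.3) object at the letter's radius is the print-regime one
near the flat point. [cite: Balaban1987RG1, (2.2)–(2.3) p.265; Balaban1985Variational, Thm 1 p.279] -/
theorem critCfgAxOfRecord_eq_of_radius_le {ν : Stage7Numerics} (hk : k ≤ (F.P K).m + (F.P K).K) (hε : 0 ≤ ε) (h : ε ≤ ν.εreg)
    {W : GaugeField (F.P K) (k + 1) (SU N)} (hu' : UniqueUkOrbit F N K (k + 1) ν.εreg W) {U₀ : GaugeField (F.P K) 0 (SU N)}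
    (h₀ : IsBackground (avOfRecord F N K) (bgReg F N K (k + 1) ε) (k + 1) W U₀)
    (hsmall : wilsonAction4 U₀ < (ε * (F.P K).eta (k + 1) ^ 2) ^ 2 / (2 * N)) :
    critCfgAxOfRecord F N ν K k W = BlockAxialRepresentative.axialize (contourOfRecord F N K k) (Averaging.iter (avOfRecord F N K) k U₀) :=
  critCfgAxOfRecord_eq_of_isBackground hk hu'
    (isBackground_of_radius_le h h₀ fun _ _ hUε _ => (hsmall.trans_le (sq_div_le_wilsonAction4_of_not_mem_bgReg hε hUε)).le)

end Radius

/-! ## (D)  The guard's INDEX SHIFT (memo §1): the ONE TokE face of `P0HolExtAtRecordGL` — level `k + 1` at volume `recordK₀ F Mc k + n` — covers the LEVEL-`k+1` selector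
`UkSel F 2 (recordK₀ F Mc (k+1) + n) (k+1) a₀ …` that `recordH1`∕`recordAUk` read at index `k + 1`, through the instance `(k, n+1)` (`recordK₀ = k + 1 + log_L Mc`); at level `0` the
(0.21) problem is the identity constraint (✓`UkSel_zero_of_mem`, ✓`uniqueUkOrbit_zero`), so every selector the body reads is under the guard.  APPEND (hand-27930-P0C g0). -/

section IndexShift

variable (F : T4Family)

/-- **Volume bookkeeping**: `recordK₀ F Mc k + (n + 1) = recordK₀ F Mc (k + 1) + n` (`recordK₀ F Mc k = k + 1 + Nat.log L Mc`). [cite: Balaban1987RG1, p.257 (the tower of volumes; bookkeeping)] -/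
theorem recordK₀_add_succ (Mc k n : ℕ) : recordK₀ F Mc k + (n + 1) = recordK₀ F Mc (k + 1) + n := by
  unfold recordK₀
  omega

/-- ★ **THE TokE FACE AT THE PREDECESSOR INDEX**: the guard of `P0HolExtAtRecordGL` (∀ k n, level `k + 1`, volume `recordK₀ F Mc k + n`) yields existence and uniqueness of the
(0.21) minimal orbit at radius `a₀` for the LEVEL-`k+1` problem at volume `recordK₀ F Mc (k + 1) + n` — the selector inside `recordH1 F (k+1) (recordK₀ F Mc (k+1) + n) a₀ …` — by the
instance `(k, n + 1)` and a `subst` along `recordK₀_add_succ`. [cite: Balaban1985Variational, Thm 1 p.279; Balaban1987RG1, (2.3) p.265 (bookkeeping)] -/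
theorem tokE_at_succ_volume {Mc : ℕ} {ε₁ a₀ : ℝ}
    (hG : ∀ (k n : ℕ) (V : GaugeField (F.P (recordK₀ F Mc k + n)) (k + 1) (SU 2)), PlaqSmall ε₁ V →
      UkExists F 2 (recordK₀ F Mc k + n) (k + 1) a₀ V ∧ UniqueUkOrbit F 2 (recordK₀ F Mc k + n) (k + 1) a₀ V)
    (k n : ℕ) (V : GaugeField (F.P (recordK₀ F Mc (k + 1) + n)) (k + 1) (SU 2)) (hV : PlaqSmall ε₁ V) :
    UkExists F 2 (recordK₀ F Mc (k + 1) + n) (k + 1) a₀ V ∧ UniqueUkOrbit F 2 (recordK₀ F Mc (k + 1) + n) (k + 1) a₀ V := by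
  have key : ∀ K : ℕ, recordK₀ F Mc k + (n + 1) = K → ∀ W : GaugeField (F.P K) (k + 1) (SU 2), PlaqSmall ε₁ W →
      UkExists F 2 K (k + 1) a₀ W ∧ UniqueUkOrbit F 2 K (k + 1) a₀ W := by
    rintro K rfl W hW
    exact hG k (n + 1) W hW
  exact key _ (recordK₀_add_succ F Mc k n) V hV

/-- **At level `0` nothing is asked of the guard**: the (0.21) problem at level `0` is the identity constraint, solvable exactly on `bgReg … 0 a₀` with a trivially unique orbit,
and the selector is the identity there. [cite: Balaban1987RG1, (0.21) p.256 (bookkeeping)] -/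
theorem tokE_levelZero {K : ℕ} {a₀ : ℝ} (V : GaugeField (F.P K) 0 (SU 2)) (hV : V ∈ bgReg F 2 K 0 a₀) :
    UkExists F 2 K 0 a₀ V ∧ UniqueUkOrbit F 2 K 0 a₀ V ∧ UkSel F 2 K 0 a₀ V = V :=
  ⟨ukExists_zero_iff.2 hV, uniqueUkOrbit_zero V, UkSel_zero_of_mem hV⟩

end IndexShift

end Summit.QuantumFields.YangMills.Theorems.BalabanUVNodesPortS1

end
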